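import Mathlib
import Summits.Ventures.HodgeRepro2.T5IndexTwoCharacter
import Summits.Ventures.HodgeRepro2.T5AdicCompletionNormGroup
import Summits.Ventures.HodgeRepro2.T5TameRamifiedNormGroup

/-!
# The local norm character `η_v` as a kernel object, at inert and tamely ramified places

`η_v := signChar (normGroup σ)` — the unique character `Kvˣ →* ℤˣ` with kernel the norm group
`N(Lwˣ)` — exists as soon as the norm group has index 2 (`T5AdicCompletionNormGroup` at inert
places, `T5TameRamifiedNormGroup` at tamely ramified places).  This file packages it
(`normChar`), with the two computations route/T5-route-2.md uses:

* INERT: `η_v` is unramified (`normChar_eq_one_of_val_eq_one`) and `η_v(ϖ) = −1`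
  (`normChar_uniformizer_eq_neg_one`) — the unramified quadratic character;
* TAMELY RAMIFIED: on units `η_v(u) = 1 ⟺ ū is a square` (`normChar_units_eq_one_iff`) — the
  Legendre symbol of the residue (route (A8a) / (A11)) — and `η_v(N θ) = 1` for the norm `−θ²` of the
  anti-invariant uniformiser.

Any character of `Kvˣ` trivial on norms is `1` or `η_v` (`eq_one_or_eq_normChar`).

Declaration per README §8(d): «uses an L-value-free non-vanishing device: NO».
-/

namespace Summit.Ventures.HodgeRepro2.T5LocalNormCharacter

open IsDedekindDomain HeightOneSpectrum IsLocalRing WithZero T5AdicCompletionNormGroup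
  T5IndexTwoCharacter

variable {K : Type*} [Field K] [NumberField K] (v : HeightOneSpectrum (NumberField.RingOfIntegers K))
  {L : Type*} [Field L] [NumberField L] [Algebra K L]
  (w : HeightOneSpectrum (NumberField.RingOfIntegers L)) [w.asIdeal.LiesOver v.asIdeal]
  (σ : Gal(adicCompletion L w/adicCompletion K v)) (hind : (normGroup v w σ).index = 2)

/-- THE LOCAL NORM CHARACTER `η_v : Kvˣ →* ℤˣ`: the sign character of the norm group. -/
noncomputable def normChar : (adicCompletion K v)ˣ →* ℤˣ := signChar (normGroup v w σ) hind

/-- `η_v = 1` on norms. -/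
theorem normChar_apply_of_mem {y : (adicCompletion K v)ˣ} (hy : y ∈ normGroup v w σ) :
    normChar v w σ hind y = 1 :=
  signChar_apply_of_mem _ hind hy

/-- `η_v = −1` off the norm group. -/
theorem normChar_apply_of_notMem {y : (adicCompletion K v)ˣ} (hy : y ∉ normGroup v w σ) :
    normChar v w σ hind y = -1 :=
  signChar_apply_of_notMem _ hind hy

/-- `η_v y = 1 ⟺ y` is a norm. -/
theorem normChar_eq_one_iff (y : (adicCompletion K v)ˣ) :
    normChar v w σ hind y = 1 ↔ y ∈ normGroup v w σ :=
  signChar_eq_one_iff _ hind y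

/-- `η_v y = −1 ⟺ y` is not a norm. -/
theorem normChar_eq_neg_one_iff (y : (adicCompletion K v)ˣ) :
    normChar v w σ hind y = -1 ↔ y ∉ normGroup v w σ :=
  signChar_eq_neg_one_iff _ hind y

/-- `η_v` is trivial on norms `x · σ x`. -/
theorem normChar_mul_algEquiv (y : (adicCompletion K v)ˣ) (x : adicCompletion L w)
    (hx : x * σ x = algebraMap (adicCompletion K v) (adicCompletion L w) (y : adicCompletion K v)) :
    normChar v w σ hind y = 1 :=
  (normChar_eq_one_iff v w σ hind y).mpr ⟨x, hx⟩

/-- `η_v` is quadratic and non-trivial, and is the unique character with kernel the norm group. -/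
theorem normChar_sq (y : (adicCompletion K v)ˣ) : normChar v w σ hind y ^ 2 = 1 := signChar_sq _ hind y

/-- `η_v ≠ 1`. -/
theorem normChar_ne_one : normChar v w σ hind ≠ 1 := signChar_ne_one _ hind

/-- Uniqueness: a character `Kvˣ →* ℤˣ` whose kernel is the norm group is `η_v`. -/
theorem eq_normChar (χ : (adicCompletion K v)ˣ →* ℤˣ) (hχ : ∀ y, χ y = 1 ↔ y ∈ normGroup v w σ) :
    χ = normChar v w σ hind :=
  eq_signChar _ hind χ hχ

/-- A character `Kvˣ →* ℤˣ` trivial on norms is `1` or `η_v`. -/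
theorem eq_one_or_eq_normChar (χ : (adicCompletion K v)ˣ →* ℤˣ)
    (hχ : ∀ y ∈ normGroup v w σ, χ y = 1) : χ = 1 ∨ χ = normChar v w σ hind := by
  classical
  obtain ⟨g₀, hg₀⟩ := exists_notMem (normGroup v w σ) hind
  rcases Int.units_eq_one_or (χ g₀) with h | h
  · left
    refine MonoidHom.ext fun g => ?_
    rw [apply_eq_of_eq_one_on _ hind χ hχ hg₀ g, h, MonoidHom.one_apply, ite_self]
  · right
    refine MonoidHom.ext fun g => ?_
    rw [apply_eq_of_eq_one_on _ hind χ hχ hg₀ g, h]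
    by_cases hg : g ∈ normGroup v w σ
    · rw [if_pos hg, normChar_apply_of_mem v w σ hind hg]
    · rw [if_neg hg, normChar_apply_of_notMem v w σ hind hg]


/-- The principal units `{y ∈ Kvˣ | v (y − 1) < 1}` form an open set of `Kvˣ`. -/
theorem isOpen_setOf_val_sub_one_lt_one :
    IsOpen {y : (adicCompletion K v)ˣ | Valued.v ((y : adicCompletion K v) - 1) < 1} := by
  have : {y : (adicCompletion K v)ˣ | Valued.v ((y : adicCompletion K v) - 1) < 1} =
      (fun y : (adicCompletion K v)ˣ => (y : adicCompletion K v) - 1) ⁻¹'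
        {x : adicCompletion K v | 1 ≤ Valued.v x}ᶜ := by
    ext y
    simp only [Set.mem_setOf_eq, Set.mem_preimage, Set.mem_compl_iff, not_le]
  rw [this]
  exact (T5AdicCompletionNormSurjective.isClosed_setOf_one_le_val.isOpen_compl).preimage
    (Units.continuous_val.sub continuous_const)

/-- `η_v` is continuous as soon as the norm group contains the principal units (the kernel is then
open; `ℤˣ` is discrete). -/
theorem continuous_normChar_of_principal
    (h : ∀ y : (adicCompletion K v)ˣ, Valued.v ((y : adicCompletion K v) - 1) < 1 → y ∈ normGroup v w σ) :
    Continuous (normChar v w σ hind) := by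
  have hopen : IsOpen ((normGroup v w σ : Subgroup (adicCompletion K v)ˣ) : Set (adicCompletion K v)ˣ) := by
    apply Subgroup.isOpen_of_mem_nhds (g := 1)
    exact Filter.mem_of_superset ((isOpen_setOf_val_sub_one_lt_one v).mem_nhds (by simp)) (fun y hy => h y hy)
  exact T5ProfiniteCharacterExtension.continuous_of_eq_one_on_open_subgroup (normChar v w σ hind)
    (normGroup v w σ) hopen (fun y hy => normChar_apply_of_mem v w σ hind hy)

section Inert

variable (h2 : Module.finrank (adicCompletion K v) (adicCompletion L w) = 2)
  {ϖ : adicCompletionIntegers K v} (hϖ : Irreducible ϖ)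
  (hϖS : Irreducible (algebraMap (adicCompletionIntegers K v) (adicCompletionIntegers L w) ϖ))
  (hσ : σ ≠ 1)

include h2 hϖ hϖS hσ in
/-- INERT: `η_v` is UNRAMIFIED — trivial on the units of `O_Kv`. -/
theorem normChar_eq_one_of_val_eq_one {y : (adicCompletion K v)ˣ}
    (hy : Valued.v (y : adicCompletion K v) = 1) : normChar v w σ hind y = 1 :=
  (normChar_eq_one_iff v w σ hind y).mpr (mem_normGroup_of_val_eq_one v w σ h2 hϖ hϖS hσ hy)

include h2 hϖ hϖS hσ in
/-- INERT: `η_v(ϖ) = −1` — `η_v` is THE unramified quadratic character. -/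
theorem normChar_uniformizer_eq_neg_one :
    normChar v w σ hind (uniformizerUnit v hϖ) = -1 := by
  rw [normChar_eq_neg_one_iff, mem_normGroup_iff_even v w σ h2 hϖ hϖS hσ, coe_uniformizerUnit,
    val_uniformizer v hϖ, log_exp]
  decide

include h2 hϖ hϖS hσ in
/-- INERT: `η_v(y) = η_v(ϖ)^{−log v(y)}` — the explicit unramified formula (with
`normChar_uniformizer_eq_neg_one`: `η_v(y) = (−1)^{v(y)}`). -/
theorem normChar_apply_eq_zpow (y : (adicCompletion K v)ˣ) :
    normChar v w σ hind y =
      normChar v w σ hind (uniformizerUnit v hϖ) ^ (-(Valued.v (y : adicCompletion K v)).log) :=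
  apply_eq_zpow v w σ h2 hϖ hϖS hσ (normChar v w σ hind)
    (fun z hz => (normChar_eq_one_iff v w σ hind z).mpr hz) y

include h2 hϖ hϖS hσ in
/-- INERT: `η_v` is continuous. -/
theorem continuous_normChar : Continuous (normChar v w σ hind) :=
  continuous_normChar_of_principal v w σ hind fun y hy =>
    mem_normGroup_of_val_eq_one v w σ h2 hϖ hϖS hσ (by
      have h1 : Valued.v (y : adicCompletion K v) = Valued.v ((y : adicCompletion K v) - 1 + 1) := by
        rw [sub_add_cancel]
      have h2' : Valued.v ((y : adicCompletion K v) - 1 + 1) = Valued.v (1 : adicCompletion K v) :=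
        Valuation.map_add_eq_of_lt_right _ (by rw [map_one]; exact hy)
      rw [h1, h2', map_one])

end Inert

section TameRamified

variable (h2 : Module.finrank (adicCompletion K v) (adicCompletion L w) = 2)
  {ϖ : adicCompletionIntegers K v} (hϖ : Irreducible ϖ)
  {π : adicCompletionIntegers L w} (hπ : Irreducible π)
  (hram : ¬ Irreducible (algebraMap (adicCompletionIntegers K v) (adicCompletionIntegers L w) ϖ))
  (hσ : σ ≠ 1) (h2u : IsUnit (2 : adicCompletionIntegers K v))

include h2 hϖ hπ hram hσ h2u in
/-- TAMELY RAMIFIED: on units, `η_v(u) = 1 ⟺ ū is a square` — the Legendre symbol of the residue. -/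
theorem normChar_units_eq_one_iff (u : (adicCompletion K v)ˣ) (hu : Valued.v (u : adicCompletion K v) = 1) :
    normChar v w σ hind u = 1 ↔ IsSquare (residue (adicCompletionIntegers K v)
      ⟨(u : adicCompletion K v), (mem_adicCompletionIntegers _ _ _).mpr hu.le⟩) := by
  rw [normChar_eq_one_iff, T5TameRamifiedNormGroup.mem_normGroup_iff_isSquare_residue v w σ h2 hϖ hπ hram hσ h2u u hu]

include h2 hϖ hπ hram hσ h2u in
/-- TAMELY RAMIFIED: `η_v` is ramified — it is `−1` on some unit (a non-square residue). -/
theorem exists_units_normChar_eq_neg_one :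
    ∃ u : (adicCompletion K v)ˣ, Valued.v (u : adicCompletion K v) = 1 ∧ normChar v w σ hind u = -1 := by
  obtain ⟨ε, hε⟩ := T5TameRamifiedUnitNorms.exists_units_not_isSquare_residue v h2u
  have hεv : Valued.v ((ε : adicCompletionIntegers K v) : adicCompletion K v) = 1 :=
    T5AdicCompletionHenselian.val_coe_units_eq_one v ε
  refine ⟨Units.map ((adicCompletionIntegers K v).subtype : adicCompletionIntegers K v →* adicCompletion K v) ε,
    by simpa using hεv, ?_⟩
  rw [normChar_eq_neg_one_iff, T5TameRamifiedNormGroup.mem_normGroup_iff_isSquare_residue v w σ h2 hϖ hπ hram hσ h2u _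
    (by simpa using hεv)]
  convert hε
  rfl

include h2 hϖ hπ hram hσ in
/-- TAMELY RAMIFIED: `η_v(N θ) = 1` for the norm `ρ = −θ²` of the anti-invariant uniformiser. -/
theorem normChar_eq_one_of_anti {θ : adicCompletion L w} (hθ : σ θ = -θ) (hθv : Valued.v θ = exp (-1)) :
    ∃ ρ : (adicCompletion K v)ˣ, Valued.v (ρ : adicCompletion K v) = exp (-1) ∧ normChar v w σ hind ρ = 1 := by
  obtain ⟨ρ, hρv, hρN⟩ := T5TameRamifiedNormGroup.exists_uniformizer_mem_normGroup v w σ h2 hϖ hπ hram hσ hθ hθv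
  exact ⟨ρ, hρv, (normChar_eq_one_iff v w σ hind ρ).mpr hρN⟩

include h2 hϖ hπ hram hσ h2u in
/-- TAMELY RAMIFIED: `η_v` is trivial on the principal units `1 + 𝔪_Kv` (conductor exponent `1`):
a unit `≡ 1 (mod 𝔪)` has residue `1 = 1²`. -/
theorem normChar_eq_one_of_val_sub_one_lt_one (u : (adicCompletion K v)ˣ)
    (hu : Valued.v (u : adicCompletion K v) = 1)
    (hu1 : Valued.v ((u : adicCompletion K v) - 1) < 1) : normChar v w σ hind u = 1 := by
  rw [normChar_units_eq_one_iff v w σ hind h2 hϖ hπ hram hσ h2u u hu]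
  have hmem : (u : adicCompletion K v) - 1 ∈ adicCompletionIntegers K v :=
    (mem_adicCompletionIntegers _ _ _).mpr hu1.le
  have h0 : residue (adicCompletionIntegers K v) ⟨(u : adicCompletion K v) - 1, hmem⟩ = 0 := by
    rw [residue_eq_zero_iff, T5AdicCompletionResidueField.mem_maximalIdeal_iff]
    exact hu1
  have e : (⟨(u : adicCompletion K v), (mem_adicCompletionIntegers _ _ _).mpr hu.le⟩ : adicCompletionIntegers K v) =
      ⟨(u : adicCompletion K v) - 1, hmem⟩ + 1 := by
    apply Subtype.ext; simp
  rw [e, map_add, map_one, h0, zero_add]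
  exact ⟨1, by simp⟩

include h2 hϖ hπ hram hσ h2u in
/-- TAMELY RAMIFIED: `η_v` is continuous. -/
theorem continuous_normChar_of_tame : Continuous (normChar v w σ hind) :=
  continuous_normChar_of_principal v w σ hind fun y hy => by
    have hu : Valued.v (y : adicCompletion K v) = 1 := by
      have h1 : Valued.v (y : adicCompletion K v) = Valued.v ((y : adicCompletion K v) - 1 + 1) := by
        rw [sub_add_cancel]
      have h2' : Valued.v ((y : adicCompletion K v) - 1 + 1) = Valued.v (1 : adicCompletion K v) :=
        Valuation.map_add_eq_of_lt_right _ (by rw [map_one]; exact hy)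
      rw [h1, h2', map_one]
    exact (normChar_eq_one_iff v w σ hind y).mp
      (normChar_eq_one_of_val_sub_one_lt_one v w σ hind h2 hϖ hπ hram hσ h2u y hu hy)

end TameRamified

end Summit.Ventures.HodgeRepro2.T5LocalNormCharacter
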